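import Mathlib
import Summits.AtomisticToContinuum.Crystallization.Theorems.ThreeConeCertificateExactCertificateTransfer1DMinGap

/-!
# Crux `ExactCertificate` (stmt-AtomisticToContinuum-11959), line `closure-makes-nogap-exact`,
# Transfer skeleton IV `SlackRigidity1D` — stub `stub_deleteEnergy`: deletion identity for the line energy

Support file (`--supports stmt-AtomisticToContinuum-11959`) for the crux
`ThreeConeCertificate.ExactCertificate`; nothing here closes the 3-D crux.

Transfer skeleton IV (`…Cruxes.ExactCertificate.Transfer1D.SlackRigidity1D`: slack rigidity of the
Lennard-Jones CHAIN, i.e. the route decl `SlackRigidity` with `3 ↦ 1`) starts with a CROWDING SURGERY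
that deletes particles one at a time.  This file proves its pure bookkeeping step (`stub_deleteEnergy`):
for ANY pair function `V` and ANY positions `y : ℕ → ℝ` (no monotonicity is used), the line energy
`∑_{i<j<N} V(|y j − y i|)` equals the line energy of the `(N−1)`-point re-indexed configuration `y'`
(index `i₀` removed: `y' k = y k` for `k < i₀`, `y' k = y (k+1)` for `k ≥ i₀`) plus the site energy of
`i₀` (pairs `(i₀, j)`, `j > i₀`, written `V(|y j − y i₀|)`, and pairs `(p, i₀)`, `p < i₀`, written
`V(|y i₀ − y p|)`).

Mechanism: induction on `N ≥ i₀ + 1`, peeling the top index off the triangular sum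
(`slackDel_peel`: `L(n+1) = L(n) + ∑_{i<n} F i n`).  At `N = i₀ + 1` the deleted particle is the top
one and `y' = y` below it.  In the step `N ↦ N + 1` the new top row `∑_{i<N} V(|y N − y i|)` splits at
`i₀` (`slackDel_row`) into the top row of `y'` (whose top particle is `y' (N−1) = y N`) and the new
site-energy term `V(|y N − y i₀|)`.
-/

noncomputable section

namespace Summit.AtomisticToContinuum.Crystallization.Theorems.ThreeConeCertificateExactCertificate.Transfer1D

open Literature.MathematicalPhysics.StatisticalMechanics
open scoped BigOperators

/-- Peeling the top index off the triangular pair sum: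
`∑_{i<j<n+1} f i j = ∑_{i<j<n} f i j + ∑_{i<n} f i n`. [folklore] -/
theorem slackDel_peel (f : ℕ → ℕ → ℝ) (n : ℕ) :
    ∑ i ∈ Finset.range (n + 1), ∑ j ∈ Finset.Ico (i + 1) (n + 1), f i j =
      ∑ i ∈ Finset.range n, ∑ j ∈ Finset.Ico (i + 1) n, f i j + ∑ i ∈ Finset.range n, f i n := by
  rw [Finset.sum_range_succ, Finset.Ico_self, Finset.sum_empty, add_zero, ← Finset.sum_add_distrib]
  refine Finset.sum_congr rfl fun i hi => ?_
  rw [Finset.mem_range] at hi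
  exact Finset.sum_Ico_succ_top (Nat.succ_le_of_lt hi) _

/-- Splitting a row at the deleted index: for `i₀ ≤ m`,
`∑_{i<m+1} g i = ∑_{i<m} g (e i) + g i₀` with `e i = i` for `i < i₀` and `e i = i + 1` for `i ≥ i₀`.
[folklore] -/
theorem slackDel_row (g : ℕ → ℝ) {i₀ m : ℕ} (h : i₀ ≤ m) :
    ∑ i ∈ Finset.range (m + 1), g i =
      ∑ i ∈ Finset.range m, (if i < i₀ then g i else g (i + 1)) + g i₀ := by
  simp only [Finset.range_eq_Ico]
  rw [← Finset.sum_Ico_consecutive _ (Nat.zero_le i₀) (Nat.le_succ_of_le h),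
    ← Finset.sum_Ico_consecutive _ (Nat.zero_le i₀) h,
    Finset.sum_eq_sum_Ico_succ_bot (Nat.lt_succ_of_le h)]
  have h1 : ∑ i ∈ Finset.Ico 0 i₀, (if i < i₀ then g i else g (i + 1)) =
      ∑ i ∈ Finset.Ico 0 i₀, g i :=
    Finset.sum_congr rfl fun i hi => by
      rw [Finset.mem_Ico] at hi
      rw [if_pos hi.2]
  have h2 : ∑ i ∈ Finset.Ico i₀ m, (if i < i₀ then g i else g (i + 1)) =
      ∑ i ∈ Finset.Ico (i₀ + 1) (m + 1), g i := by
    rw [← Finset.sum_Ico_add' g i₀ m 1]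
    exact Finset.sum_congr rfl fun i hi => by
      rw [Finset.mem_Ico] at hi
      rw [if_neg (by omega)]
  rw [h1, h2]
  ring

/-- STUB (A1) `stub_deleteEnergy` — DELETION IDENTITY for the line energy (any pair function `V`, any
`y`): deleting index `i₀` (re-indexing `y' k = y k` for `k < i₀`, `y' k = y (k+1)` for `k ≥ i₀`)
removes exactly the pairs containing `i₀`, i.e. the line energy of `y` on `range N` is the line energy
of `y'` on `range (N − 1)` plus the site energy of particle `i₀`. [folklore] -/
theorem stub_deleteEnergy : ∀ (V : ℝ → ℝ) (N i₀ : ℕ) (y y' : ℕ → ℝ), i₀ < N →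
    (∀ k : ℕ, y' k = if k < i₀ then y k else y (k + 1)) →
    ∑ i ∈ Finset.range N, ∑ j ∈ Finset.Ico (i + 1) N, V (|y j - y i|) =
      ∑ i ∈ Finset.range (N - 1), ∑ j ∈ Finset.Ico (i + 1) (N - 1), V (|y' j - y' i|) +
        (∑ j ∈ Finset.Ico (i₀ + 1) N, V (|y j - y i₀|) + ∑ p ∈ Finset.range i₀, V (|y i₀ - y p|)) := by
  intro V N i₀ y y' hi₀ hy'
  obtain ⟨m, rfl⟩ : ∃ m, N = m + 1 := ⟨N - 1, by omega⟩
  rw [Nat.add_sub_cancel]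
  have hm : i₀ ≤ m := Nat.lt_succ_iff.1 hi₀
  clear hi₀
  induction m, hm using Nat.le_induction with
  | base =>
    -- the deleted particle is the top one: no pairs `(i₀, j)`, and `y' = y` below `i₀`
    rw [slackDel_peel (fun i j => V (|y j - y i|)) i₀, Finset.Ico_self, Finset.sum_empty, zero_add]
    congr 1
    refine Finset.sum_congr rfl fun i hi => Finset.sum_congr rfl fun j hj => ?_
    rw [Finset.mem_range] at hi
    rw [Finset.mem_Ico] at hj
    rw [hy' i, hy' j, if_pos hi, if_pos hj.2]
  | succ m hm ih =>
    -- peel the top particle `y (m+1) = y' m` off both line energies and split its row at `i₀`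
    rw [slackDel_peel (fun i j => V (|y j - y i|)) (m + 1), ih,
      slackDel_peel (fun i j => V (|y' j - y' i|)) m,
      Finset.sum_Ico_succ_top (show i₀ + 1 ≤ m + 1 by omega) (fun j => V (|y j - y i₀|)),
      slackDel_row (fun i => V (|y (m + 1) - y i|)) hm]
    have hrow : ∑ i ∈ Finset.range m, V (|y' m - y' i|) =
        ∑ i ∈ Finset.range m,
          (if i < i₀ then V (|y (m + 1) - y i|) else V (|y (m + 1) - y (i + 1)|)) := by
      refine Finset.sum_congr rfl fun i _ => ?_
      rw [hy' m, if_neg (not_lt.2 hm), hy' i]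
      split_ifs <;> rfl
    rw [hrow]
    ring

end Summit.AtomisticToContinuum.Crystallization.Theorems.ThreeConeCertificateExactCertificate.Transfer1D
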